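import Summits.AtomisticToContinuum.BoseEinsteinCondensation.Theses.BECConjugateDomination
import Summits.AtomisticToContinuum.BoseEinsteinCondensation.Theorems.BECConjugateDominationHardCoreExtensionTruncationEnergyConvergenceAll
import Literature.Barriers.AtomisticToContinuum.KineticGapLengthScalesThermodynamicWindow
import Literature.MathematicalPhysics.QuantumManyBody.PeriodicKineticBudget
import HarnessLib

/-!
# Near-minimiser slack transfer along the truncation tower: `HardCoreExtension` modulo ONE thermodynamic statement
# (crux `BECConjugateDomination.HardCoreExtension`, stmt-AtomisticToContinuum-11786 — line `near-minimiser-slack-transfer`, lead c7)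

The crux `HardCoreExtension := A → BoseEinsteinCondensation` (`A` = dilute ground-state BEC for every smooth-class
potential, pointwise in the potential) is reduced here to a single thermodynamic statement **T★** and the route item
`BoundaryTransferWeak` (stmt-0827), with everything else PROVED and nothing else assumed — no connectivity (Lemma G), no
simplicity or spectral gap of any limit problem, no regularity or positivity of minimisers, no smooth approximation:

* **T★(v)** (near-minimiser truncation-tower BEC): there is `ρ₀ > 0` such that for `0 < ρ < ρ₀` some `c > 0` satisfies:
  for all large `N` there are ONE slack `δ > 0` and a level `n₀` such that for every `n ≥ n₀` every periodic trial state
  on the torus of side `(N/ρ)^{1/3}` with `min(v,n)`-energy `≤ E₀^per(min(v,n)) + δ` has constant-mode occupation `≥ cN`.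
  For BOUNDED `v` this is literally near-minimiser periodic BEC of `v` (`nearMinimiserTowerBEC_iff_of_bounded`), i.e. the
  hypothesis of `BoundaryTransferWeak v` (the route's target `SmoothPeriodicBEC`, stmt-11783, is its smooth-class
  instance); for `hardCorePotential a` it is height-uniform soft-sphere near-minimiser BEC.

Mechanism (slack matching, `nearMinBEC_of_minorantTower`): the periodic trial class does not depend on the potential; for
a pointwise minorant `w ≤ v` with `E₀(v) ≤ E₀(w) + δ'` at fixed `(N, L)`, every `δ'`-near-minimiser of `v` is a
`2δ'`-near-minimiser of `w`. Along the truncation tower the energy deficit `E₀(v) − E₀(min(v,n))` tends to `0` at fixed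
volume for EVERY admissible `v` (landed `stub_truncationEnergyConvergenceAll`, over `maxFormBound_of_isRepulsiveFiniteRange`),
and `E₀^per(v; N, L_N) < ⊤` eventually at small density (Ruelle, `exists_eventually_periodicGroundStateEnergy_lt_top`).

Theorems: `nearMinBEC_of_minorantTower` (fixed volume, any tower of minorants); `periodicBEC_of_minorantTowerBEC` (any
tower with fixed-volume energy convergence); `periodicBEC_of_nearMinimiserTowerBEC` (T★(v) ⇒ `PeriodicBEC(v)`);
`boseEinsteinCondensation_of_nearMinimiserTowerBEC`, `hardCoreExtension_of_nearMinimiserTowerBEC`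
(`(∀ v, T★(v)) → BoundaryTransferWeak → HardCoreExtension`); `nearMinimiserTowerBEC_iff_of_bounded`;
`nearMinimiserTowerBEC_of_uniformBoundedClass` (a class form ⇒ T★); `diluteBEC_hardSpheres_of_nearMinimiserTowerBEC`
(height-uniform soft-sphere near-minimiser BEC + the boundary transfer ⇒ hard-sphere BEC at all small densities).

References: E. H. Lieb, R. Seiringer, J. P. Solovej, J. Yngvason, *The Mathematics of the Bose Gas and its Condensation*
(2005), §1.2 (1.17)–(1.19), Ch. 2, Ch. 5 p. 42; D. Ruelle, *Statistical Mechanics* (1969), §3.5.11; M. Reed, B. Simon,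
*Methods of Modern Mathematical Physics IV* (1978), Thm XIII.64.
-/

noncomputable section

namespace Summit.AtomisticToContinuum.BoseEinsteinCondensation.Cruxes.HardCoreExtension.NearMinTower

open MeasureTheory Filter
open scoped ENNReal NNReal Topology
open Literature.MathematicalPhysics.QuantumManyBody.BoseGas
open Summit.AtomisticToContinuum.BoseEinsteinCondensation.Theses.BECConjugateDomination

/-! ## The slack-matching transfer along a tower of minorants (fixed volume) -/

/-- **Slack transfer along a tower of minorants** (the lever, proved). At fixed `(N, L)`: if `wₙ ≤ v` pointwise,
`E₀(v) ≤ E₀(wₙ) + ε` for all large `n` (every `ε > 0`), and ONE slack `δ > 0` makes, for arbitrarily large levels `n`,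
every `δ`-near-minimiser of `wₙ` have `n₀ ≥ m`, then every `δ'`-near-minimiser of `v` has `n₀ ≥ m` for some `δ' > 0`
(`δ' = min(δ,1)/2`: `E_{wₙ} Ψ ≤ E_v Ψ ≤ E₀(v) + δ' ≤ E₀(wₙ) + 2δ'`). No spectral information on `v`. [cite: LSSY2005, §1.2 (1.17)–(1.19)] -/
theorem nearMinBEC_of_minorantTower {N : ℕ} {L : ℝ} (v : ℝ → ℝ≥0∞) (w : ℕ → ℝ → ℝ≥0∞)
    (hwv : ∀ n r, w n r ≤ v r)
    (hconv : ∀ ε : ℝ, 0 < ε → ∃ n₁ : ℕ, ∀ n : ℕ, n₁ ≤ n →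
      periodicGroundStateEnergy v N L ≤ periodicGroundStateEnergy (w n) N L + ENNReal.ofReal ε)
    {m δ : ℝ≥0∞} (hδ : 0 < δ)
    (h : ∀ n₁ : ℕ, ∃ n : ℕ, n₁ ≤ n ∧ ∀ Ψ : PeriodicTrialState N L,
      periodicEnergy (w n) Ψ ≤ periodicGroundStateEnergy (w n) N L + δ → m ≤ condensateOccupation N L Ψ.ψ) :
    ∃ δ' : ℝ≥0∞, 0 < δ' ∧ ∀ Ψ : PeriodicTrialState N L,
      periodicEnergy v Ψ ≤ periodicGroundStateEnergy v N L + δ' → m ≤ condensateOccupation N L Ψ.ψ := by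
  -- a finite positive slack below `δ`
  set δ₁ : ℝ≥0∞ := min δ 1 with hδ₁
  have hδ₁pos : 0 < δ₁ := lt_min hδ one_pos
  have hδ₁top : δ₁ ≠ ⊤ := ne_top_of_le_ne_top ENNReal.one_ne_top (min_le_right _ _)
  have hδ₁le : δ₁ ≤ δ := min_le_left _ _
  have hhalf_ne : δ₁ / 2 ≠ 0 := (ENNReal.half_pos hδ₁pos.ne').ne'
  have hhalf_top : δ₁ / 2 ≠ ⊤ := ENNReal.div_ne_top hδ₁top two_ne_zero
  set ε : ℝ := (δ₁ / 2).toReal with hε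
  have hεpos : 0 < ε := ENNReal.toReal_pos hhalf_ne hhalf_top
  have hεeq : ENNReal.ofReal ε = δ₁ / 2 := ENNReal.ofReal_toReal hhalf_top
  obtain ⟨n₁, hn₁⟩ := hconv ε hεpos
  obtain ⟨n, hn, hBEC⟩ := h n₁
  refine ⟨δ₁ / 2, ENNReal.half_pos hδ₁pos.ne', fun Ψ hΨ => hBEC Ψ ?_⟩
  calc periodicEnergy (w n) Ψ ≤ periodicEnergy v Ψ := periodicEnergy_mono_of_le (hwv n) Ψ
    _ ≤ periodicGroundStateEnergy v N L + δ₁ / 2 := hΨ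
    _ ≤ periodicGroundStateEnergy (w n) N L + ENNReal.ofReal ε + δ₁ / 2 := by gcongr; exact hn₁ n hn
    _ = periodicGroundStateEnergy (w n) N L + δ₁ := by rw [hεeq, add_assoc, ENNReal.add_halves]
    _ ≤ periodicGroundStateEnergy (w n) N L + δ := by gcongr

/-! ## Compositions -/

/-- **Near-minimiser BEC along ANY tower of minorants with fixed-volume energy convergence ⇒ near-minimiser periodic BEC
of `v`** (verbatim the hypothesis of the route item `BoundaryTransferWeak v`), for every repulsive finite-range `v`:
Ruelle finiteness `E₀^per(v; N, L_N) < ⊤` eventually below `ρ₁(v)` and `nearMinBEC_of_minorantTower`. Same `c`.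
[cite: LSSY2005, §1.2 (1.19); Ruelle1969, §3.5.11] -/
theorem periodicBEC_of_minorantTowerBEC (v : ℝ → ℝ≥0∞) (hv : IsRepulsiveFiniteRange v) (w : ℕ → ℝ → ℝ≥0∞)
    (hwv : ∀ n r, w n r ≤ v r)
    (hconv : ∀ (N : ℕ) (L : ℝ), 0 < L → periodicGroundStateEnergy v N L ≠ ⊤ →
      ∀ ε : ℝ, 0 < ε → ∃ n₁ : ℕ, ∀ n : ℕ, n₁ ≤ n →
        periodicGroundStateEnergy v N L ≤ periodicGroundStateEnergy (w n) N L + ENNReal.ofReal ε)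
    (hT : ∃ ρ₀ : ℝ, 0 < ρ₀ ∧ ∀ ρ : ℝ, 0 < ρ → ρ < ρ₀ → ∃ c : ℝ, 0 < c ∧ ∀ᶠ N : ℕ in atTop,
        ∃ δ : ℝ≥0∞, 0 < δ ∧ ∃ n₀ : ℕ, ∀ n : ℕ, n₀ ≤ n →
          ∀ Ψ : PeriodicTrialState N (sideLength ρ N),
            periodicEnergy (w n) Ψ ≤ periodicGroundStateEnergy (w n) N (sideLength ρ N) + δ →
              ENNReal.ofReal (c * N) ≤ condensateOccupation N (sideLength ρ N) Ψ.ψ) :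
    ∃ ρ₀ : ℝ, 0 < ρ₀ ∧ ∀ ρ : ℝ, 0 < ρ → ρ < ρ₀ → ∃ c : ℝ, 0 < c ∧ ∀ᶠ N : ℕ in atTop,
      ∃ δ : ℝ≥0∞, 0 < δ ∧ ∀ Ψ : PeriodicTrialState N (sideLength ρ N),
        periodicEnergy v Ψ ≤ periodicGroundStateEnergy v N (sideLength ρ N) + δ →
          ENNReal.ofReal (c * N) ≤ condensateOccupation N (sideLength ρ N) Ψ.ψ := by
  obtain ⟨ρ₀, hρ₀, hth⟩ := hT
  obtain ⟨ρF, hρF, hfin⟩ :=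
    Literature.Barriers.AtomisticToContinuum.BoseGas.exists_eventually_periodicGroundStateEnergy_lt_top hv
  refine ⟨min ρ₀ ρF, lt_min hρ₀ hρF, fun ρ hρ hρlt => ?_⟩
  obtain ⟨c, hc, hN⟩ := hth ρ hρ (hρlt.trans_le (min_le_left _ _))
  refine ⟨c, hc, ?_⟩
  filter_upwards [hN, hfin ρ hρ (hρlt.trans_le (min_le_right _ _)), eventually_gt_atTop 0] with N hN₁ hN₂ hN₃
  obtain ⟨δ, hδ, n₀, h⟩ := hN₁
  have hL : 0 < sideLength ρ N := sideLength_pos_of_pos hρ hN₃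
  exact nearMinBEC_of_minorantTower v w hwv (hconv N _ hL hN₂.ne) hδ
    (fun n₁ => ⟨max n₀ n₁, le_max_right _ _, h _ (le_max_left _ _)⟩)

/-- **T★(v) ⇒ near-minimiser periodic BEC of `v`** (verbatim the hypothesis of the route item `BoundaryTransferWeak v`),
for every repulsive finite-range `v`: the truncation tower `min(v,n) ≤ v` with the landed fixed-volume truncation energy
convergence `stub_truncationEnergyConvergenceAll` (every admissible `v`, hard cores and non-integrable singularities
included). Same `c`. [cite: LSSY2005, §1.2 (1.19); ReedSimonIV1978, Thm XIII.64] -/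
theorem periodicBEC_of_nearMinimiserTowerBEC (v : ℝ → ℝ≥0∞) (hv : IsRepulsiveFiniteRange v)
    (hT : ∃ ρ₀ : ℝ, 0 < ρ₀ ∧ ∀ ρ : ℝ, 0 < ρ → ρ < ρ₀ → ∃ c : ℝ, 0 < c ∧ ∀ᶠ N : ℕ in atTop,
        ∃ δ : ℝ≥0∞, 0 < δ ∧ ∃ n₀ : ℕ, ∀ n : ℕ, n₀ ≤ n →
          ∀ Ψ : PeriodicTrialState N (sideLength ρ N),
            periodicEnergy (fun r => min (v r) (n : ℝ≥0∞)) Ψ ≤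
                periodicGroundStateEnergy (fun r => min (v r) (n : ℝ≥0∞)) N (sideLength ρ N) + δ →
              ENNReal.ofReal (c * N) ≤ condensateOccupation N (sideLength ρ N) Ψ.ψ) :
    ∃ ρ₀ : ℝ, 0 < ρ₀ ∧ ∀ ρ : ℝ, 0 < ρ → ρ < ρ₀ → ∃ c : ℝ, 0 < c ∧ ∀ᶠ N : ℕ in atTop,
      ∃ δ : ℝ≥0∞, 0 < δ ∧ ∀ Ψ : PeriodicTrialState N (sideLength ρ N),
        periodicEnergy v Ψ ≤ periodicGroundStateEnergy v N (sideLength ρ N) + δ →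
          ENNReal.ofReal (c * N) ≤ condensateOccupation N (sideLength ρ N) Ψ.ψ :=
  periodicBEC_of_minorantTowerBEC v hv (fun n r => min (v r) (n : ℝ≥0∞)) (fun _ _ => min_le_left _ _)
    (fun N L hL hE ε hε => ThirdLawCurrentFloorAlt.stub_truncationEnergyConvergenceAll v hv N L hL hE ε hε) hT

/-- **The conjunct from T★ and the boundary transfer**: `(∀ v, T★(v)) → BoundaryTransferWeak → BoseEinsteinCondensation`. [cite: LSSY2005, Ch. 5 p. 42] -/
theorem boseEinsteinCondensation_of_nearMinimiserTowerBEC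
    (hT : ∀ v : ℝ → ℝ≥0∞, IsRepulsiveFiniteRange v →
      ∃ ρ₀ : ℝ, 0 < ρ₀ ∧ ∀ ρ : ℝ, 0 < ρ → ρ < ρ₀ → ∃ c : ℝ, 0 < c ∧ ∀ᶠ N : ℕ in atTop,
        ∃ δ : ℝ≥0∞, 0 < δ ∧ ∃ n₀ : ℕ, ∀ n : ℕ, n₀ ≤ n →
          ∀ Ψ : PeriodicTrialState N (sideLength ρ N),
            periodicEnergy (fun r => min (v r) (n : ℝ≥0∞)) Ψ ≤
                periodicGroundStateEnergy (fun r => min (v r) (n : ℝ≥0∞)) N (sideLength ρ N) + δ →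
              ENNReal.ofReal (c * N) ≤ condensateOccupation N (sideLength ρ N) Ψ.ψ)
    (hbt : BoundaryTransferWeak) :
    Literature.MathematicalPhysics.QuantumManyBody.BoseGas.BoseEinsteinCondensation :=
  fun v hv => hbt v hv (periodicBEC_of_nearMinimiserTowerBEC v hv (hT v hv))

/-- **The crux from T★ and the boundary transfer**: `(∀ v, T★(v)) → BoundaryTransferWeak → HardCoreExtension` (its
own antecedent — dilute smooth-class Dirichlet BEC, pointwise in the potential — is not used; the conjunct itself is
reached, `boseEinsteinCondensation_of_nearMinimiserTowerBEC`). [cite: LSSY2005, Ch. 5 p. 42] -/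
theorem hardCoreExtension_of_nearMinimiserTowerBEC :
    (∀ v : ℝ → ℝ≥0∞, IsRepulsiveFiniteRange v →
      ∃ ρ₀ : ℝ, 0 < ρ₀ ∧ ∀ ρ : ℝ, 0 < ρ → ρ < ρ₀ → ∃ c : ℝ, 0 < c ∧ ∀ᶠ N : ℕ in atTop,
        ∃ δ : ℝ≥0∞, 0 < δ ∧ ∃ n₀ : ℕ, ∀ n : ℕ, n₀ ≤ n →
          ∀ Ψ : PeriodicTrialState N (sideLength ρ N),
            periodicEnergy (fun r => min (v r) (n : ℝ≥0∞)) Ψ ≤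
                periodicGroundStateEnergy (fun r => min (v r) (n : ℝ≥0∞)) N (sideLength ρ N) + δ →
              ENNReal.ofReal (c * N) ≤ condensateOccupation N (sideLength ρ N) Ψ.ψ) →
    BoundaryTransferWeak → HardCoreExtension :=
  fun hT hbt _ => boseEinsteinCondensation_of_nearMinimiserTowerBEC hT hbt

/-! ## What T★ is -/

/-- For a BOUNDED potential the truncation tower is eventually constant, so T★(v) is EQUIVALENT to near-minimiser
periodic BEC of `v` itself (the hypothesis of `BoundaryTransferWeak v`): the registered stub asks nothing new of bounded
potentials. [cite: LSSY2005, §1.2 (1.19)] -/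
theorem nearMinimiserTowerBEC_iff_of_bounded (v : ℝ → ℝ≥0∞) {M : ℕ} (hM : ∀ r, v r ≤ M) :
    (∃ ρ₀ : ℝ, 0 < ρ₀ ∧ ∀ ρ : ℝ, 0 < ρ → ρ < ρ₀ → ∃ c : ℝ, 0 < c ∧ ∀ᶠ N : ℕ in atTop,
        ∃ δ : ℝ≥0∞, 0 < δ ∧ ∃ n₀ : ℕ, ∀ n : ℕ, n₀ ≤ n →
          ∀ Ψ : PeriodicTrialState N (sideLength ρ N),
            periodicEnergy (fun r => min (v r) (n : ℝ≥0∞)) Ψ ≤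
                periodicGroundStateEnergy (fun r => min (v r) (n : ℝ≥0∞)) N (sideLength ρ N) + δ →
              ENNReal.ofReal (c * N) ≤ condensateOccupation N (sideLength ρ N) Ψ.ψ) ↔
    (∃ ρ₀ : ℝ, 0 < ρ₀ ∧ ∀ ρ : ℝ, 0 < ρ → ρ < ρ₀ → ∃ c : ℝ, 0 < c ∧ ∀ᶠ N : ℕ in atTop,
      ∃ δ : ℝ≥0∞, 0 < δ ∧ ∀ Ψ : PeriodicTrialState N (sideLength ρ N),
        periodicEnergy v Ψ ≤ periodicGroundStateEnergy v N (sideLength ρ N) + δ →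
          ENNReal.ofReal (c * N) ≤ condensateOccupation N (sideLength ρ N) Ψ.ψ) := by
  -- above the bound the truncation is `v` itself
  have htrunc : ∀ n : ℕ, M ≤ n → (fun r => min (v r) (n : ℝ≥0∞)) = v := by
    intro n hn
    funext r
    exact min_eq_left ((hM r).trans (by exact_mod_cast hn))
  constructor
  · rintro ⟨ρ₀, hρ₀, h⟩
    refine ⟨ρ₀, hρ₀, fun ρ hρ hlt => ?_⟩
    obtain ⟨c, hc, hN⟩ := h ρ hρ hlt
    refine ⟨c, hc, ?_⟩
    filter_upwards [hN] with N hN₁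
    obtain ⟨δ, hδ, n₀, h'⟩ := hN₁
    refine ⟨δ, hδ, fun Ψ hΨ => ?_⟩
    have h'' := h' (max n₀ M) (le_max_left _ _) Ψ
    rw [htrunc _ (le_max_right _ _)] at h''
    exact h'' hΨ
  · rintro ⟨ρ₀, hρ₀, h⟩
    refine ⟨ρ₀, hρ₀, fun ρ hρ hlt => ?_⟩
    obtain ⟨c, hc, hN⟩ := h ρ hρ hlt
    refine ⟨c, hc, ?_⟩
    filter_upwards [hN] with N hN₁
    obtain ⟨δ, hδ, h'⟩ := hN₁
    refine ⟨δ, hδ, M, fun n hn Ψ hΨ => ?_⟩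
    rw [htrunc n hn] at hΨ
    exact h' Ψ hΨ

/-- **A class form implies T★** (documentation for the planners): uniform-slack near-minimiser periodic BEC over ALL
bounded admissible potentials of range `≤ R` (the near-minimiser analogue of c6's U(R); one genuine parameter `R` by
dilation, cf. `Negative.UniformRepairNormalForm`) gives T★(v) for every admissible `v` of range `≤ R`, bounded or not. [cite: LSSY2005, §1.2 (1.19)] -/
theorem nearMinimiserTowerBEC_of_uniformBoundedClass {R : ℝ}
    (hU : ∃ ρ₀ : ℝ, 0 < ρ₀ ∧ ∀ ρ : ℝ, 0 < ρ → ρ < ρ₀ → ∃ c : ℝ, 0 < c ∧ ∀ᶠ N : ℕ in atTop,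
      ∃ δ : ℝ≥0∞, 0 < δ ∧ ∀ w : ℝ → ℝ≥0∞, IsRepulsiveFiniteRange w →
        (∃ M : ℝ≥0∞, M ≠ ⊤ ∧ ∀ r, w r ≤ M) → (∀ r, R < r → w r = 0) →
        ∀ Ψ : PeriodicTrialState N (sideLength ρ N),
          periodicEnergy w Ψ ≤ periodicGroundStateEnergy w N (sideLength ρ N) + δ →
            ENNReal.ofReal (c * N) ≤ condensateOccupation N (sideLength ρ N) Ψ.ψ)
    (v : ℝ → ℝ≥0∞) (hv : IsRepulsiveFiniteRange v) (hvR : ∀ r, R < r → v r = 0) :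
    ∃ ρ₀ : ℝ, 0 < ρ₀ ∧ ∀ ρ : ℝ, 0 < ρ → ρ < ρ₀ → ∃ c : ℝ, 0 < c ∧ ∀ᶠ N : ℕ in atTop,
        ∃ δ : ℝ≥0∞, 0 < δ ∧ ∃ n₀ : ℕ, ∀ n : ℕ, n₀ ≤ n →
          ∀ Ψ : PeriodicTrialState N (sideLength ρ N),
            periodicEnergy (fun r => min (v r) (n : ℝ≥0∞)) Ψ ≤
                periodicGroundStateEnergy (fun r => min (v r) (n : ℝ≥0∞)) N (sideLength ρ N) + δ →
              ENNReal.ofReal (c * N) ≤ condensateOccupation N (sideLength ρ N) Ψ.ψ := by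
  obtain ⟨ρ₀, hρ₀, h⟩ := hU
  refine ⟨ρ₀, hρ₀, fun ρ hρ hlt => ?_⟩
  obtain ⟨c, hc, hN⟩ := h ρ hρ hlt
  refine ⟨c, hc, ?_⟩
  filter_upwards [hN] with N hN₁
  obtain ⟨δ, hδ, h'⟩ := hN₁
  refine ⟨δ, hδ, 0, fun n _ Ψ hΨ => h' _ ?_ ⟨n, ENNReal.natCast_ne_top n, fun r => min_le_right _ _⟩
    (fun r hr => by simp [hvR r hr]) Ψ hΨ⟩
  -- admissibility of the truncation
  exact ⟨hv.1.min measurable_const, hv.2.imp fun R₀ hR₀ r hr => by simp [hR₀ r hr]⟩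

/-- **Hard spheres** (headline instance): height-uniform SOFT-SPHERE near-minimiser BEC (T★ at `hardCorePotential a`:
`min(⊤·1_{r<a}, n) = n·1_{r<a}`) and the boundary transfer give ground-state BEC of the hard-sphere gas at all small
densities. [cite: LSSY2005, Ch. 2 (after (2.1)) and Ch. 5 p. 42] -/
theorem diluteBEC_hardSpheres_of_nearMinimiserTowerBEC {a : ℝ} (hbt : BoundaryTransferWeak)
    (hT : ∃ ρ₀ : ℝ, 0 < ρ₀ ∧ ∀ ρ : ℝ, 0 < ρ → ρ < ρ₀ → ∃ c : ℝ, 0 < c ∧ ∀ᶠ N : ℕ in atTop,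
        ∃ δ : ℝ≥0∞, 0 < δ ∧ ∃ n₀ : ℕ, ∀ n : ℕ, n₀ ≤ n →
          ∀ Ψ : PeriodicTrialState N (sideLength ρ N),
            periodicEnergy (fun r => min (hardCorePotential a r) (n : ℝ≥0∞)) Ψ ≤
                periodicGroundStateEnergy (fun r => min (hardCorePotential a r) (n : ℝ≥0∞)) N (sideLength ρ N) + δ →
              ENNReal.ofReal (c * N) ≤ condensateOccupation N (sideLength ρ N) Ψ.ψ) :
    ∃ ρ₀ : ℝ, 0 < ρ₀ ∧ ∀ ρ : ℝ, 0 < ρ → ρ < ρ₀ → HasGroundStateBEC (hardCorePotential a) ρ :=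
  hbt _ (isRepulsiveFiniteRange_hardCorePotential a)
    (periodicBEC_of_nearMinimiserTowerBEC _ (isRepulsiveFiniteRange_hardCorePotential a) hT)

end Summit.AtomisticToContinuum.BoseEinsteinCondensation.Cruxes.HardCoreExtension.NearMinTower

end
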